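import Summits.QuantumFields.YangMills.Theses.SmallCircleAnchor
import Summits.QuantumFields.YangMills.Theorems.SmallCircleAnchorAdiabaticContinuityStubDecompactification
import Literature.MathematicalPhysics.QuantumLattice.GaugeGroupsProofs

/-!
# Probes for the stub `stub_thermalContinuationUniform : ThermalContinuationUniform`
# (crux `AdiabaticContinuity`, stmt-QuantumFields-11142, line `registered`, reshape r1)

Evidence file of the stub worker (wave c1); it proves NO registered stub and is not proposed.
All statements copy the skeleton's inline `ClAt` / `Cl` let-vocabulary verbatim
(`Cruxes/AdiabaticContinuity/Lines/birth.lean`, def `ThermalContinuationUniform`).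

* `thermalContinuationUniform_base_slice` — the stub with its conclusion cut down to the slice
  `T' = T`: closed by handing back the anchor hypothesis with the same constants (`ε₁ := 0`,
  `β₁ := β₀`, same `m`, same `C`). So the whole content of the stub is the extension from the
  anchor extent `T` to EVERY `T' > T` with `T'`-uniform constants.
* `legA_pointwise_of_uniform` — the stub's conclusion (one `C` per `w` serving every `T' ≥ T`)
  implies the crux's `T'`-pointwise Leg A `∀ T' ≥ T, Cl (fun _ => T') (E β) β m` (same rate).
* `clAt_smallVolume_uniform` — degenerate instances carry no content, uniformly in `T'`: for
  `L ≤ 2K + 1` (so every admissible separation `n` is `≤ K`) the clause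
  `ClAt (fun _ => T') s β m w (2 e^{mK}) L` holds for EVERY `T'`, every `s, β`, every `m ≥ 0` and
  every `w`, by `|connected corr| ≤ 2` (`abs_connected_le_two`; the inline weight is a continuous,
  hence integrable, positive density on the compact configuration space). In particular `L = 1, 2`
  (`K = 0`, `C = 2`) never obstruct a `T'`-uniform constant.
* `isCompactSimpleLieGroup_su` — the outer hypothesis `IsCompactSimpleLieGroup G` IS witnessed in
  the tree (`G = SU(n)`, `n ≥ 2`): the tree's `isSimpleCompactGroup_specialUnitaryGroup_holds`
  (proved, `Literature.MathematicalPhysics.QuantumLattice.GaugeGroupsProofs`) discharges the named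
  fact consumed by `isCompactSimpleLieGroup_specialUnitaryGroup`. So the stub is not vacuous for
  lack of a gauge group; a refutation on a concrete `G` would still need PROVED anchor clustering.
-/

namespace Summit.QuantumFields.YangMills.Theorems.SmallCircleAnchor.ThermalContinuationUniformProbes

open scoped BigOperators Topology Manifold Classical MeasureTheory ProbabilityTheory Matrix InnerProductSpace ComplexConjugate ContinuousMap
open Filter Set Function TopologicalSpace MeasureTheory

/-- **Base slice.** The stub `ThermalContinuationUniform` with its conclusion restricted to the
anchor extent `T' = T` holds trivially: the anchor hypothesis is handed back with the same
constants. -/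
theorem thermalContinuationUniform_base_slice :
  ∀ (G : Type) [Group G] [TopologicalSpace G] [IsTopologicalGroup G] [CompactSpace G],
    Literature.MathematicalPhysics.QuantumFieldTheory.IsCompactSimpleLieGroup G →
    letI : MeasurableSpace G := borel G; haveI : BorelSpace G := ⟨rfl⟩;
    ∀ (r : Literature.MathematicalPhysics.QuantumFieldTheory.LatticeRep G) (V : G → ℝ),
    (Continuous V ∧ (∀ a g : G, V (a * g * a⁻¹) = V g) ∧ ∃ g₀ : G, (∀ g : G, V g₀ ≤ V g) ∧ (∀ g : G, V g = V g₀ → ∃ a : G, g = a * g₀ * a⁻¹) ∧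
      (∀ a b : G, a * g₀ = g₀ * a → b * g₀ = g₀ * b → a * b = b * a)) →
    ∀ (T : ℕ) [NeZero T],
    let ClAt := fun (τ : ℕ → ℕ) (s β m : ℝ) (w : ℕ) (C : ℝ) (L : ℕ) =>
      ∀ [NeZero L] [NeZero (τ L)],
      let St := ZMod (τ L) × (Fin 3 → ZMod L);
      let Cfg := St × Option (Fin 3) → G;
      let ν : MeasureTheory.Measure Cfg := MeasureTheory.Measure.pi fun _ => Literature.MathematicalPhysics.QuantumFieldTheory.haarProbability G;
      let sh : St → Option (Fin 3) → St := fun x μ => Option.elim μ (x.1 + 1, x.2) fun i => (x.1, x.2 + Pi.single i 1);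
      let pl : Cfg → St → Option (Fin 3) → Option (Fin 3) → G := fun U x μ κ => U (x, μ) * U (sh x μ, κ) * (U (sh x κ, μ))⁻¹ * (U (x, κ))⁻¹;
      let act : Cfg → ℝ := fun U => β * ∑ x : St, ∑ i : Fin 3, (r.ρ (pl U x none (some i))).trace.re + β * ∑ x : St, ∑ q : {q : Fin 3 × Fin 3 // q.1 < q.2}, (r.ρ (pl U x (some q.1.1) (some q.1.2))).trace.re;
      let P : Cfg → (Fin 3 → ZMod L) → G := fun U x => (List.ofFn fun t : Fin (τ L) => U ((((t : ℕ) : ZMod (τ L)), x), none)).prod;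
      let wgt : Cfg → ℝ := fun U => Real.exp (act U - s * ∑ x : Fin 3 → ZMod L, V (P U x));
      let Ex : (Cfg → ℝ) → ℝ := fun F => (∫ U, F U * wgt U ∂ν) / (∫ U, wgt U ∂ν);
      let σ : ℕ → Cfg → Cfg := fun n U p => U ((p.1.1, p.1.2 + Pi.single 0 (n : ZMod L)), p.2);
      ∀ (c : Fin 3 → ZMod L),
      let Loc := fun F : Cfg → ℝ => Measurable F ∧ (∀ U, |F U| ≤ 1) ∧ ∀ U U', (∀ p, (∀ i : Fin 3, (p.1.2 i - c i).val ≤ w) → U p = U' p) → F U = F U';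
      ∀ F₁ F₂ : Cfg → ℝ, Loc F₁ → Loc F₂ → ∀ n : ℕ, 2 * n < L →
        |Ex (fun U => F₁ U * F₂ (σ n U)) - Ex F₁ * Ex (fun U => F₂ (σ n U))| ≤ C * Real.exp (-(m * n));
    let Cl := fun (τ : ℕ → ℕ) (s β m : ℝ) => ∀ w : ℕ, ∃ C : ℝ, ∀ L : ℕ, ClAt τ s β m w C L;
    ∃ ε₁ : ℝ, ∀ E : ℝ → ℝ, (∀ β : ℝ, ε₁ ≤ E β) → ∀ β₀ : ℝ,
      (∀ β : ℝ, β₀ ≤ β → ∃ m : ℝ, 0 < m ∧ Cl (fun _ => T) (E β) β m) →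
      ∃ β₁ : ℝ, ∀ β : ℝ, β₁ ≤ β → ∃ m : ℝ, 0 < m ∧
        ∀ w : ℕ, ∃ C : ℝ, ∀ (T' : ℕ), T' = T → ∀ L : ℕ, ClAt (fun _ => T') (E β) β m w C L := by
  intro G _ _ _ _ hG
  letI : MeasurableSpace G := borel G
  haveI : BorelSpace G := ⟨rfl⟩
  intro r V hV T _ ClAt Cl
  refine ⟨0, fun E hE β₀ hanch => ⟨β₀, fun β hβ => ?_⟩⟩
  obtain ⟨m, hm, hCl⟩ := hanch β hβ
  refine ⟨m, hm, fun w => ?_⟩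
  obtain ⟨C, hC⟩ := hCl w
  refine ⟨C, fun T' hT' L => ?_⟩
  subst hT'
  exact hC L

/-- **Uniform ⟹ pointwise.** The conclusion of `ThermalContinuationUniform` (for every `w` ONE
constant `C` serving every `T' ≥ T` and every `L`) implies the crux's Leg A read `T'`-pointwise:
`Cl (fun _ => T') (E β) β m` for every `T' ≥ T`, at the same rate. -/
theorem legA_pointwise_of_uniform :
  ∀ (G : Type) [Group G] [TopologicalSpace G] [IsTopologicalGroup G] [CompactSpace G],
    Literature.MathematicalPhysics.QuantumFieldTheory.IsCompactSimpleLieGroup G →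
    letI : MeasurableSpace G := borel G; haveI : BorelSpace G := ⟨rfl⟩;
    ∀ (r : Literature.MathematicalPhysics.QuantumFieldTheory.LatticeRep G) (V : G → ℝ),
    (Continuous V ∧ (∀ a g : G, V (a * g * a⁻¹) = V g) ∧ ∃ g₀ : G, (∀ g : G, V g₀ ≤ V g) ∧ (∀ g : G, V g = V g₀ → ∃ a : G, g = a * g₀ * a⁻¹) ∧
      (∀ a b : G, a * g₀ = g₀ * a → b * g₀ = g₀ * b → a * b = b * a)) →
    ∀ (T : ℕ) [NeZero T],
    let ClAt := fun (τ : ℕ → ℕ) (s β m : ℝ) (w : ℕ) (C : ℝ) (L : ℕ) =>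
      ∀ [NeZero L] [NeZero (τ L)],
      let St := ZMod (τ L) × (Fin 3 → ZMod L);
      let Cfg := St × Option (Fin 3) → G;
      let ν : MeasureTheory.Measure Cfg := MeasureTheory.Measure.pi fun _ => Literature.MathematicalPhysics.QuantumFieldTheory.haarProbability G;
      let sh : St → Option (Fin 3) → St := fun x μ => Option.elim μ (x.1 + 1, x.2) fun i => (x.1, x.2 + Pi.single i 1);
      let pl : Cfg → St → Option (Fin 3) → Option (Fin 3) → G := fun U x μ κ => U (x, μ) * U (sh x μ, κ) * (U (sh x κ, μ))⁻¹ * (U (x, κ))⁻¹;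
      let act : Cfg → ℝ := fun U => β * ∑ x : St, ∑ i : Fin 3, (r.ρ (pl U x none (some i))).trace.re + β * ∑ x : St, ∑ q : {q : Fin 3 × Fin 3 // q.1 < q.2}, (r.ρ (pl U x (some q.1.1) (some q.1.2))).trace.re;
      let P : Cfg → (Fin 3 → ZMod L) → G := fun U x => (List.ofFn fun t : Fin (τ L) => U ((((t : ℕ) : ZMod (τ L)), x), none)).prod;
      let wgt : Cfg → ℝ := fun U => Real.exp (act U - s * ∑ x : Fin 3 → ZMod L, V (P U x));
      let Ex : (Cfg → ℝ) → ℝ := fun F => (∫ U, F U * wgt U ∂ν) / (∫ U, wgt U ∂ν);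
      let σ : ℕ → Cfg → Cfg := fun n U p => U ((p.1.1, p.1.2 + Pi.single 0 (n : ZMod L)), p.2);
      ∀ (c : Fin 3 → ZMod L),
      let Loc := fun F : Cfg → ℝ => Measurable F ∧ (∀ U, |F U| ≤ 1) ∧ ∀ U U', (∀ p, (∀ i : Fin 3, (p.1.2 i - c i).val ≤ w) → U p = U' p) → F U = F U';
      ∀ F₁ F₂ : Cfg → ℝ, Loc F₁ → Loc F₂ → ∀ n : ℕ, 2 * n < L →
        |Ex (fun U => F₁ U * F₂ (σ n U)) - Ex F₁ * Ex (fun U => F₂ (σ n U))| ≤ C * Real.exp (-(m * n));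
    let Cl := fun (τ : ℕ → ℕ) (s β m : ℝ) => ∀ w : ℕ, ∃ C : ℝ, ∀ L : ℕ, ClAt τ s β m w C L;
    ∀ (E : ℝ → ℝ) (β m : ℝ),
      (∀ w : ℕ, ∃ C : ℝ, ∀ (T' : ℕ), T ≤ T' → ∀ L : ℕ, ClAt (fun _ => T') (E β) β m w C L) →
      ∀ (T' : ℕ) [NeZero T'], T ≤ T' → Cl (fun _ => T') (E β) β m := by
  intro G _ _ _ _ hG
  letI : MeasurableSpace G := borel G
  haveI : BorelSpace G := ⟨rfl⟩
  intro r V hV T _ ClAt Cl E β m hA T' _ hT' w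
  obtain ⟨C, hC⟩ := hA w
  exact ⟨C, fun L => hC T' hT' L⟩

/-- **Small volumes are free, uniformly in `T'`.** If `L ≤ 2K + 1` then every admissible
separation `n` (`2n < L`) is `≤ K`, and the clause `ClAt (fun _ => T') s β m w (2e^{mK}) L` holds
for every temporal extent `T'`, every `s, β`, every rate `m ≥ 0` and every cube side `w`, by the
trivial bound `|connected corr| ≤ 2`. -/
theorem clAt_smallVolume_uniform :
  ∀ (G : Type) [Group G] [TopologicalSpace G] [IsTopologicalGroup G] [CompactSpace G],
    Literature.MathematicalPhysics.QuantumFieldTheory.IsCompactSimpleLieGroup G →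
    letI : MeasurableSpace G := borel G; haveI : BorelSpace G := ⟨rfl⟩;
    ∀ (r : Literature.MathematicalPhysics.QuantumFieldTheory.LatticeRep G) (V : G → ℝ),
    (Continuous V ∧ (∀ a g : G, V (a * g * a⁻¹) = V g) ∧ ∃ g₀ : G, (∀ g : G, V g₀ ≤ V g) ∧ (∀ g : G, V g = V g₀ → ∃ a : G, g = a * g₀ * a⁻¹) ∧
      (∀ a b : G, a * g₀ = g₀ * a → b * g₀ = g₀ * b → a * b = b * a)) →
    ∀ (T : ℕ) [NeZero T],
    let ClAt := fun (τ : ℕ → ℕ) (s β m : ℝ) (w : ℕ) (C : ℝ) (L : ℕ) =>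
      ∀ [NeZero L] [NeZero (τ L)],
      let St := ZMod (τ L) × (Fin 3 → ZMod L);
      let Cfg := St × Option (Fin 3) → G;
      let ν : MeasureTheory.Measure Cfg := MeasureTheory.Measure.pi fun _ => Literature.MathematicalPhysics.QuantumFieldTheory.haarProbability G;
      let sh : St → Option (Fin 3) → St := fun x μ => Option.elim μ (x.1 + 1, x.2) fun i => (x.1, x.2 + Pi.single i 1);
      let pl : Cfg → St → Option (Fin 3) → Option (Fin 3) → G := fun U x μ κ => U (x, μ) * U (sh x μ, κ) * (U (sh x κ, μ))⁻¹ * (U (x, κ))⁻¹;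
      let act : Cfg → ℝ := fun U => β * ∑ x : St, ∑ i : Fin 3, (r.ρ (pl U x none (some i))).trace.re + β * ∑ x : St, ∑ q : {q : Fin 3 × Fin 3 // q.1 < q.2}, (r.ρ (pl U x (some q.1.1) (some q.1.2))).trace.re;
      let P : Cfg → (Fin 3 → ZMod L) → G := fun U x => (List.ofFn fun t : Fin (τ L) => U ((((t : ℕ) : ZMod (τ L)), x), none)).prod;
      let wgt : Cfg → ℝ := fun U => Real.exp (act U - s * ∑ x : Fin 3 → ZMod L, V (P U x));
      let Ex : (Cfg → ℝ) → ℝ := fun F => (∫ U, F U * wgt U ∂ν) / (∫ U, wgt U ∂ν);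
      let σ : ℕ → Cfg → Cfg := fun n U p => U ((p.1.1, p.1.2 + Pi.single 0 (n : ZMod L)), p.2);
      ∀ (c : Fin 3 → ZMod L),
      let Loc := fun F : Cfg → ℝ => Measurable F ∧ (∀ U, |F U| ≤ 1) ∧ ∀ U U', (∀ p, (∀ i : Fin 3, (p.1.2 i - c i).val ≤ w) → U p = U' p) → F U = F U';
      ∀ F₁ F₂ : Cfg → ℝ, Loc F₁ → Loc F₂ → ∀ n : ℕ, 2 * n < L →
        |Ex (fun U => F₁ U * F₂ (σ n U)) - Ex F₁ * Ex (fun U => F₂ (σ n U))| ≤ C * Real.exp (-(m * n));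
    ∀ (s β m : ℝ), 0 ≤ m → ∀ (w K T' L : ℕ), L ≤ 2 * K + 1 →
      ClAt (fun _ => T') s β m w (2 * Real.exp (m * K)) L := by
  intro G _ _ _ _ hG
  letI : MeasurableSpace G := borel G
  haveI : BorelSpace G := ⟨rfl⟩
  intro r V hV T _ ClAt s β m hm w K T' L hLK hL hτ
  -- `G` is second countable (closed embedding `r.ρ` into matrices), so continuous maps on the
  -- finite product `Cfg` are measurable for the product σ-algebra.
  haveI : SecondCountableTopology G :=
    (r.continuous.isClosedEmbedding r.injective).isEmbedding.secondCountableTopology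
  intro St Cfg ν sh pl act P wgt Ex σ c Loc F₁ F₂ hF₁ hF₂ n hn
  have hexp : 0 ≤ Real.exp (-(m * n)) := (Real.exp_pos _).le
  have hPcont : ∀ x : Fin 3 → ZMod L, Continuous fun U : Cfg => P U x := by
    intro x
    show Continuous fun U : Cfg =>
      (List.ofFn fun t : Fin T' => U ((((t : ℕ) : ZMod T'), x), none)).prod
    simp only [List.ofFn_eq_map]
    exact continuous_list_prod _ fun t _ => continuous_apply _
  have hpl : ∀ (x : St) (μ κ : Option (Fin 3)), Continuous fun U : Cfg => pl U x μ κ := by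
    intro x μ κ
    show Continuous fun U : Cfg => U (x, μ) * U (sh x μ, κ) * (U (sh x κ, μ))⁻¹ * (U (x, κ))⁻¹
    fun_prop
  have htr : ∀ (x : St) (μ κ : Option (Fin 3)),
      Continuous fun U : Cfg => (r.ρ (pl U x μ κ)).trace.re := fun x μ κ =>
    Complex.continuous_re.comp (r.continuous.comp (hpl x μ κ)).matrix_trace
  have hact : Continuous act :=
    (continuous_const.mul (continuous_finsetSum _ fun x _ =>
      continuous_finsetSum _ fun i _ => htr x none (some i))).add
    (continuous_const.mul (continuous_finsetSum _ fun x _ =>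
      continuous_finsetSum _ fun q _ => htr x (some q.1.1) (some q.1.2)))
  have hwgt : Continuous wgt :=
    Real.continuous_exp.comp (hact.sub (continuous_const.mul
      (continuous_finsetSum _ fun x _ => hV.1.comp (hPcont x))))
  have hwi : Integrable wgt ν :=
    hwgt.integrable_of_hasCompactSupport (HasCompactSupport.of_compactSpace _)
  have hpos : 0 < ∫ U, wgt U ∂ν := integral_exp_pos hwi
  have hw0 : ∀ U, 0 ≤ wgt U := fun U => Real.exp_nonneg _
  have h2 : |Ex (fun U => F₁ U * F₂ (σ n U)) - Ex F₁ * Ex (fun U => F₂ (σ n U))| ≤ 2 :=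
    abs_connected_le_two hw0 hwi hpos hF₁.2.1 (fun U => hF₂.2.1 _)
  have hnK : (n : ℝ) ≤ K := by
    have : n ≤ K := by omega
    exact_mod_cast this
  have hone : 1 ≤ Real.exp (m * K) * Real.exp (-(m * n)) := by
    rw [← Real.exp_add]
    exact Real.one_le_exp (by nlinarith)
  calc _ ≤ 2 := h2
    _ ≤ 2 * Real.exp (m * K) * Real.exp (-(m * n)) := by nlinarith
    _ = 2 * Real.exp (m * K) * Real.exp (-(m * ↑n)) := rfl

/-- **A Lean witness of the gauge-group hypothesis.** `SU(n)`, `n ≥ 2`, is a compact simple Lie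
group in the crux's sense (`IsSimpleCompactGroup ∧ Nonempty LatticeRep`), unconditionally: the
tree proves the simplicity of `SU(n)` (`isSimpleCompactGroup_specialUnitaryGroup_holds`). -/
theorem isCompactSimpleLieGroup_su {n : ℕ} (hn : 2 ≤ n) :
    Literature.MathematicalPhysics.QuantumFieldTheory.IsCompactSimpleLieGroup
      (Matrix.specialUnitaryGroup (Fin n) ℂ) :=
  Literature.MathematicalPhysics.QuantumFieldTheory.isCompactSimpleLieGroup_specialUnitaryGroup
    Literature.MathematicalPhysics.QuantumLattice.isSimpleCompactGroup_specialUnitaryGroup_holds hn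

end Summit.QuantumFields.YangMills.Theorems.SmallCircleAnchor.ThermalContinuationUniformProbes
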